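import Mathlib.Topology.Instances.ZMod
import Mathlib.Topology.Algebra.Constructions
import Mathlib.Topology.Algebra.Group.Basic
import Literature.IUT.HodgeTheaters.TemperedCoverings
import Literature.IUT.HodgeTheaters.GlobalFrobenioidsKummer
import HarnessLib

/-!
# FACT-LIST (director-abc (C3)): universal closures of the [IUTchI] §2 tempered-covering predicates
# `ProfiniteConjugatesOfCompactSubgroups`, `CommensuratorsOfDecompositionSubgroups`, `TemperedNormallyTerminal`,
# `Prop24i/ii/iii` and of `NoSolvableFactorization` are FALSE — kernel refutations at ONE degenerate datum

S. Mochizuki, *Inter-universal Teichmüller theory I*, §2 (Prop. 2.1, 2.2, Rmk 2.2.2, Prop. 2.4) and Ex. 5.1,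
kurims manuscript (May 2020) pp. 45–51, 128 [claim: Mochizuki2012, status: disputed].  The frozen FACT-LIST
rows F-2589 / F-2590 / F-2591 / F-2599 / F-2600 / F-2601 (tranches 192–193 of plan/F-TRANCHES.tsv) and F-2583
(tranche 190) are `Prop`-valued STRUCTURES over the interface data `TemperedGraphGroupData` /
`StableCurveTemperedData` / `FundamentalExtension` of `TemperedCoverings.lean` / `GlobalFrobenioidsKummer.lean`
(abc-iut-L5-t1): predicates typing the printed propositions about the GENUINE data (Π^tp_𝔾 ↪ Π̂_𝔾 of a pro-Σ
semi-graph of PSC-type; Π^tp_X ↪ Π̂_X of a curve with stable reduction; `π₁(C_{F_mod}) ↠ G_{F_mod}`).  Their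
UNIVERSAL CLOSURES («for all interface data») are false: this PROOF-ONLY file exhibits ONE finite abelian datum
(`Π^tp := ℤ/2 ↪ Π̂ := ℤ/2 × ℤ/2` by the first inclusion, trivial `G_k`, no cusps/points, `Σ = {2}`,
`Σ̂ = Primes`) at which all six §2 predicates FAIL (`exists_temperedData_not_props`), and the identity
extension `ℤ/2 = ℤ/2` at which `NoSolvableFactorization` fails for every `solKer`.  Consequence for the
bookkeeping only: these rows are SCHEMAS — consumable at the genuine datum (the instance obligations
`h21`/`h22`/`h24i`/`h24ii`/… of the L5 kernels), never as closed facts.  Refuting a universal closure says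
NOTHING about print; no side is taken on [IUTchIII] Cor. 3.12; typed ≠ proved.
-/

namespace Literature.IUT.HodgeTheaters

namespace FactListClosureRefutations

open Literature.AnabelianGeometry.AbsoluteAnabelian Literature.AnabelianGeometry.SemiGraphs
open scoped Pointwise

/-- The second coordinate of an element of the image of the first inclusion `ℤ/2 ↪ ℤ/2 × ℤ/2` is trivial;
`(1, -1)` is not in that image. [folklore] -/
private theorem not_mem_range_inl :
    ((1, Multiplicative.ofAdd 1) : Multiplicative (ZMod 2) × Multiplicative (ZMod 2)) ∉
      (MonoidHom.inl (Multiplicative (ZMod 2)) (Multiplicative (ZMod 2))).range := by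
  rintro ⟨l, hl⟩
  have h := congrArg Prod.snd hl
  simp only [MonoidHom.inl_apply] at h
  exact absurd h (by decide)

/-- In the abelian group `ℤ/2 × ℤ/2` conjugation is trivial. [folklore] -/
private theorem conj_eq (γ x : Multiplicative (ZMod 2) × Multiplicative (ZMod 2)) : γ * x * γ⁻¹ = x := by
  rw [mul_right_comm, mul_inv_cancel, one_mul]

/-- In an abelian group no proper subgroup is commensurably terminal: every element commensurates it.
[folklore] -/
private theorem not_isCommensurablyTerminal_of_comm {G : Type*} [CommGroup G] {H : Subgroup G} {g : G}
    (hg : g ∉ H) : ¬ IsCommensurablyTerminal H := by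
  intro h
  have hmem : g ∈ Subgroup.Commensurable.commensurator H := by
    have hn : H.Normal := inferInstance
    rw [Subgroup.Commensurable.commensurator_mem_iff, hn.conjAct]
  rw [h.commensurator_eq] at hmem
  exact hg hmem

/-- **ONE degenerate datum refutes the universal closures of all six §2 predicates.**  At
`Π^tp_X = Π^tp_𝔾 := ℤ/2 ↪ Π̂_X = Π̂_𝔾 := ℤ/2 × ℤ/2` (first inclusion; finite, abelian, discrete), `G_k := 1`,
`Σ := {2} ⊆ Σ̂ := Primes`, `p := 3`, `ℍ`-subgroups trivial, no cusps, no points: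
Prop. 2.1 (`ProfiniteConjugatesOfCompactSubgroups`), Prop. 2.2 (`CommensuratorsOfDecompositionSubgroups`),
Rmk 2.2.2 (`TemperedNormallyTerminal`), Prop. 2.4 (i) (ii) (iii) all FAIL — the element `(1,−1) ∉ Π^tp`
conjugates/commensurates/normalises everything.  SCHEMA evidence only; the genuine tempered data are untouched.
([IUTchI] Prop 2.1/2.2/2.4 pp.45-50) [claim: Mochizuki2012, status: disputed] -/
theorem exists_temperedData_not_props :
    ∃ D : StableCurveTemperedData.{0},
      ¬ D.graph.ProfiniteConjugatesOfCompactSubgroups ∧ ¬ D.graph.CommensuratorsOfDecompositionSubgroups ∧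
      ¬ D.graph.TemperedNormallyTerminal ∧ ¬ D.Prop24i ∧ ¬ D.Prop24ii ∧ ¬ D.Prop24iii := by
  let T := Multiplicative (ZMod 2)
  let P := Multiplicative (ZMod 2) × Multiplicative (ZMod 2)
  let γ : P := (1, Multiplicative.ofAdd 1)
  let 𝒢 : TemperedGraphGroupData.{0} :=
    { Sigma := {2}
      SigmaHat := {q | q.Prime}
      sigma_subset := by
        intro q hq
        rw [Set.mem_singleton_iff] at hq
        subst hq
        exact Nat.prime_two
      sigma_nonempty := ⟨2, rfl⟩
      sigmaHat_prime := fun _ hq => hq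
      Tp := T
      Hat := P
      ι := MonoidHom.inl T T
      ι_continuous := continuous_of_discreteTopology
      ι_injective := Function.LeftInverse.injective (g := Prod.fst) fun _ => rfl
      TpH := ⊥
      HatH := ⊥
      tpH_le := by simp }
  refine ⟨{ graph := 𝒢
            p := 3
            p_notMem := by decide
            PiTp := T
            PiHat := P
            Gk := Multiplicative (ZMod 1)
            ιX := MonoidHom.inl T T
            ιX_continuous := continuous_of_discreteTopology
            ιX_injective := Function.LeftInverse.injective (g := Prod.fst) fun _ => rfl
            prTp := 1
            prHat := 1
            prTp_surjective := fun _ => ⟨1, Subsingleton.elim _ _⟩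
            prHat_comp := MonoidHom.one_comp _
            ρTp := (MonoidHom.ker (1 : T →* Multiplicative (ZMod 1))).subtype
            ρHat := (MonoidHom.ker (1 : P →* Multiplicative (ZMod 1))).subtype
            ρTp_surjective := fun y => ⟨⟨y, by simp⟩, rfl⟩
            ρHat_surjective := fun y => ⟨⟨y, by simp⟩, rfl⟩
            ρ_comp := fun _ => rfl
            Cusp := PEmpty
            inertiaTp := fun x => x.elim
            cuspMeetsH := fun x => x.elim
            Pt := PEmpty
            decompTp := fun x => x.elim }, ?_, ?_, ?_, ?_, ?_, ?_⟩
  · -- Prop 2.1 at 𝒢: Λ := Π^tp (finite, nontrivial), γ := (1,−1)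
    rintro ⟨h⟩
    have hΛ : (⊤ : Subgroup T) ≠ ⊥ := by
      intro htop
      have := (Subgroup.eq_bot_iff_forall _).1 htop (Multiplicative.ofAdd 1) (Subgroup.mem_top _)
      exact absurd this (by decide)
    refine not_mem_range_inl (h ⊤ (by rw [Subgroup.coe_top]; exact isCompact_univ) hΛ γ fun l _ => ?_)
    show γ * MonoidHom.inl T T l * γ⁻¹ ∈ (MonoidHom.inl T T).range
    rw [conj_eq]
    exact ⟨l, rfl⟩
  · -- Prop 2.2 at 𝒢: Π̂_ℍ := 1 is not commensurably terminal in ℤ/2 × ℤ/2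
    rintro ⟨h, -, -, -⟩
    exact not_isCommensurablyTerminal_of_comm (H := (⊥ : Subgroup P)) (g := γ)
      (by rw [Subgroup.mem_bot]; decide) h
  · -- Rmk 2.2.2 at 𝒢 (Σ̂ = Primes): Π^tp = ℤ/2 × 1 is not normally terminal in the abelian ℤ/2 × ℤ/2
    rintro ⟨h⟩
    have hN := (h rfl).normalizer_eq
    have hγ : γ ∈ Subgroup.normalizer ((MonoidHom.inl T T).range : Set P) := by
      rw [Subgroup.mem_normalizer_iff]
      intro x
      rw [conj_eq]
    rw [hN] at hγ
    exact not_mem_range_inl hγ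
  · -- Prop 2.4 (i): Λ := Δ^tp_X = Π^tp_X (pro-{2}, finite, nontrivial), γ := (1,−1)
    rintro ⟨h⟩
    have hΛ : (⊤ : Subgroup (MonoidHom.ker (1 : T →* Multiplicative (ZMod 1)))) ≠ ⊥ := by
      intro htop
      have := (Subgroup.eq_bot_iff_forall _).1 htop ⟨Multiplicative.ofAdd 1, by simp⟩
        (Subgroup.mem_top _)
      rw [Subtype.ext_iff] at this
      exact absurd this (by decide)
    have hσ : IsProSigma ({2} : Set ℕ) (⊤ : Subgroup (MonoidHom.ker (1 : T →* Multiplicative (ZMod 1)))) := by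
      refine ⟨fun U _ q hq hdvd => ?_⟩
      have hT : Nat.card T = 2 := by simp [T, Nat.card_eq_fintype_card]
      have h2 : Nat.card ((⊤ : Subgroup (MonoidHom.ker (1 : T →* Multiplicative (ZMod 1)))) ⧸ U.toSubgroup) ∣
          Nat.card T :=
        (Subgroup.card_quotient_dvd_card _).trans
          ((Subgroup.card_subgroup_dvd_card _).trans (Subgroup.card_subgroup_dvd_card _))
      rw [hT] at h2
      exact (Nat.prime_dvd_prime_iff_eq hq Nat.prime_two).1 (hdvd.trans h2)
    refine not_mem_range_inl (h ⊤ (by rw [Subgroup.coe_top]; exact isCompact_univ) hΛ hσ γ fun l _ => ?_)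
    show γ * MonoidHom.inl T T l * γ⁻¹ ∈ _
    rw [conj_eq]
    exact Subgroup.mem_map_of_mem _ l.2
  · -- Prop 2.4 (ii) (Σ̂ = Primes): Λ := Π^tp_X, image in G_k = 1 open
    rintro ⟨h⟩
    have hΛ : (⊤ : Subgroup T) ≠ ⊥ := by
      intro htop
      have := (Subgroup.eq_bot_iff_forall _).1 htop (Multiplicative.ofAdd 1) (Subgroup.mem_top _)
      exact absurd this (by decide)
    refine not_mem_range_inl (h rfl ⊤ (by rw [Subgroup.coe_top]; exact isCompact_univ) hΛ
      (isOpen_discrete _) γ fun l _ => ?_)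
    show γ * MonoidHom.inl T T l * γ⁻¹ ∈ (MonoidHom.inl T T).range
    rw [conj_eq]
    exact ⟨l, rfl⟩
  · -- Prop 2.4 (iii): Π^tp_X = ℤ/2 × 1 is not commensurably terminal in the abelian Π̂_X
    rintro ⟨-, h⟩
    exact not_isCommensurablyTerminal_of_comm (H := (MonoidHom.inl T T).range) (g := γ) not_mem_range_inl h

/-- **F-2589 is a schema**: `∃ D, ¬ D.ProfiniteConjugatesOfCompactSubgroups` (Prop. 2.1).
([IUTchI] Prop 2.1 p.45) [claim: Mochizuki2012, status: disputed] -/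
theorem exists_not_profiniteConjugatesOfCompactSubgroups :
    ∃ D : TemperedGraphGroupData.{0}, ¬ D.ProfiniteConjugatesOfCompactSubgroups :=
  let ⟨D, h, _⟩ := exists_temperedData_not_props
  ⟨D.graph, h⟩

/-- **F-2590 is a schema**: `∃ D, ¬ D.CommensuratorsOfDecompositionSubgroups` (Prop. 2.2).
([IUTchI] Prop 2.2 p.45) [claim: Mochizuki2012, status: disputed] -/
theorem exists_not_commensuratorsOfDecompositionSubgroups :
    ∃ D : TemperedGraphGroupData.{0}, ¬ D.CommensuratorsOfDecompositionSubgroups :=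
  let ⟨D, _, h, _⟩ := exists_temperedData_not_props
  ⟨D.graph, h⟩

/-- **F-2591 is a schema**: `∃ D, ¬ D.TemperedNormallyTerminal` (Rmk 2.2.2; at a datum with `Σ̂ = Primes`).
([IUTchI] Rmk 2.2.2 p.46) [claim: Mochizuki2012, status: disputed] -/
theorem exists_not_temperedNormallyTerminal :
    ∃ D : TemperedGraphGroupData.{0}, ¬ D.TemperedNormallyTerminal :=
  let ⟨D, _, _, h, _⟩ := exists_temperedData_not_props
  ⟨D.graph, h⟩

/-- **F-2599 / F-2600 / F-2601 are schemas**: `∃ D, ¬ D.Prop24i ∧ ¬ D.Prop24ii ∧ ¬ D.Prop24iii` (Prop. 2.4).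
([IUTchI] Prop 2.4 p.50) [claim: Mochizuki2012, status: disputed] -/
theorem exists_not_prop24 :
    ∃ D : StableCurveTemperedData.{0}, ¬ D.Prop24i ∧ ¬ D.Prop24ii ∧ ¬ D.Prop24iii :=
  let ⟨D, _, _, _, h⟩ := exists_temperedData_not_props
  ⟨D, h⟩

/-- **F-2583 is a schema**: at the IDENTITY extension `ℤ/2 = ℤ/2` (so `Δ = 1`) the universal closure of
`NoSolvableFactorization E solKer` ([IUTchI] Ex. 5.1 (v), via Lemma 2.7 / [NodNon]) FAILS for every `solKer`:
every `g` acts on `Δ = 1` as the identity element of `Δ` does.  SCHEMA evidence only; the genuine extension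
`π₁(C_{F_mod}) ↠ G_{F_mod}` is untouched. ([IUTchI] Ex 5.1 (v) p.128) [claim: Mochizuki2012, status: disputed] -/
theorem not_noSolvableFactorization_id (solKer : Subgroup (ProfiniteGrp.of (Multiplicative (ZMod 2)))) :
    ¬ NoSolvableFactorization
        ⟨ProfiniteGrp.of (Multiplicative (ZMod 2)), ProfiniteGrp.of (Multiplicative (ZMod 2)),
          ContinuousMonoidHom.id _, Function.surjective_id⟩ solKer := by
  rintro ⟨h⟩
  refine h fun g _ => ⟨1, Subgroup.one_mem _, fun x hx => ?_⟩
  have hx1 : x = 1 := hx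
  subst hx1
  simp

end FactListClosureRefutations

end Literature.IUT.HodgeTheaters
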